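import Literature.Probability.RandomPlanarGeometry.KlebanZagierTheta
import Literature.Probability.RandomPlanarGeometry.GaussIncompleteBeta
import Mathlib.NumberTheory.ModularForms.EisensteinSeries.E2.Summable
import HarnessLib

/-!
# Kleban–Zagier, Theorem 2 (corrected): `Π₁(r) = Π_h(r;α)` — PROVED

Third and last file of the proof of Theorem 2 of P. Kleban, D. Zagier, *Crossing probabilities
and modular forms*, J. Stat. Phys. **113** (2003), 431–454, §5, in its corrected form (the
literal statement, `KlebanZagier.theorem2`, is refuted by the constant block `Π₁ ≡ 1/2`:
`KlebanZagier.theorem2_false`):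

* **`KlebanZagier.theorem2_corrected`**: if `Π₁` is a conformal block of dimension `α ∈ ℝ`
  (`IsConformalBlock Π₁ α a`) with coefficients of polynomial growth, `Π₁(1/r) = 1 - Π₁(r)`
  (`r > 0`), and `Π₁` is not constant on `(0,∞)`, then `0 < α ≤ 1/2` and
  `Π₁(r) = genCardyFunction α (modularLambdaI r)` (`= F(λ(ir); 4/(1-α)) = Π_h(r;α)`) for all
  `r > 0`.
* `KlebanZagier.theorem2_constant_case`, `KlebanZagier.theorem2_dichotomy`: under (i′), (ii) as
  printed, either `Π₁` is the constant block `1/2` of dimension `0` (the counterexample to the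
  literal statement) or the conclusion of Theorem 2 holds.

## Proof (continuing `KlebanZagierDimension`, `KlebanZagierTheta`)

With `f = P′` (`blockDer`), `0 < α ≤ 1/2`, `f` zero-free and `N(f)² = cη²⁴` (`Package`):

1. `EtaLogDeriv`, `BlockLogDeriv`: `η′/η = πi/12 + O(q)` (Mathlib's `logDeriv_eta_eq_E2` and
   `E₂ = 1 - 24∑σ₁(n)qⁿ`), hence `N′/N = 12η′/η = πi + O(q̂)`; `f′/f = πiα + O(q̂)`.
2. `WDefect`: `w := f′/f - 4θ₃′/θ₃ - α v`, `v = (λ(1-λ))′/(λ(1-λ)) = 4θ₂′/θ₂ + 4θ₄′/θ₄ - 8θ₃′/θ₃`,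
   is holomorphic on `ℍ`, `2`-periodic, `w(-1/τ) = τ²w(τ)`, and `w`, `w(·+1)`, `w|₂TS` are `O(q̂)`
   (the last through `f((τ-1)/τ) = τ²N/(f f(·+1))`), so `N(w) ∈ S₆(SL₂(ℤ)) = 0` and **`w = 0`**
   (`eq_zero_plus`). This is the printed proof's "`f₁` and the right-hand side of (pihpr) have the
   same [data], these two functions must be proportional", done at level one.
3. `Axis`: on the positive imaginary axis `t ↦ f(it)` and `Ψ(t) = θ₃(it)⁴ (λ(1-λ))^α(it)` (real
   power of the positive real `λ(1-λ)(it)`) satisfy the same first-order linear ODE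
   `y′ = i(f′/f)(it) y`, hence **`f(it) = K Ψ(t)`**.
4. `LambdaAxis`: `λ(it) ∈ (0,1)`, `(d/dt)λ(it) = -πλθ₄⁴(it)` (from `λ′ = πiθ₄⁴λ`),
   `λ(i/t) = 1 - λ(it)`, `λ(it) → 0`; `modularLambdaI = λ(i·)`.
5. `Final`: `P′(t) = Re(i f(it)) = κ₁ g(t)` and, by Gauss's incomplete-beta identity
   (`GaussIncompleteBeta.hasDerivAt_rpow_mul_hypergeometric_gauss`),
   `(d/dt) Π_h(t;α) = c_T g(t)` with the same `g = θ₃⁴(λ(1-λ))^α`; `P, Π_h(·;α) → 0` at `t = ∞`,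
   so `P = κ Π_h(·;α)`; the duality (ii), `λ(i/t) = 1-λ(it)`, `Π_h(0⁺) = 0` and `Π_h(1⁻) = 1`
   (Euler's beta integral, `integral_betaKernel_eq_Gamma`) give `κ = 1`.

## References

* P. Kleban, D. Zagier, *Crossing probabilities and modular forms*, J. Stat. Phys. 113 (2003),
  431–454, §3 (`λ`, `F(λ;κ)`, (pihpr)), §5 Theorem 2. [KlebanZagier2003]
* G. E. Andrews, R. Askey, R. Roy, *Special Functions*, CUP (1999), Thms 1.1.4, 2.2.1–2.2.2.
  [AndrewsAskeyRoy1999]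
-/

noncomputable section

open Complex Real Filter Topology Asymptotics Set

open scoped Real

namespace Literature.Probability.RandomPlanarGeometry.KlebanZagier

/-! ### `η′/η = πi/12 + O(q)` (through `E₂ = 1 - 24 ∑ σ₁(n) qⁿ`) -/

section EtaLogDeriv

open scoped ArithmeticFunction.sigma

/-- The coefficients of `E₂ = 1 - 24 ∑_{n≥1} σ₁(n) qⁿ`. [folklore] -/
def e2coef (m : ℕ) : ℂ := if m = 0 then 1 else -24 * (σ 1 m : ℂ)

/-- `‖e2coef m‖ ≤ 24 (m+1)²` (`σ₁(m) ≤ m²`). [folklore] -/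
theorem norm_e2coef_le (m : ℕ) : ‖e2coef m‖ ≤ 24 * ((m : ℝ) + 1) ^ 2 := by
  unfold e2coef
  split_ifs with h
  · subst h; norm_num
  · rw [norm_mul, norm_neg, Complex.norm_natCast, show ‖(24 : ℂ)‖ = 24 by norm_num]
    apply mul_le_mul_of_nonneg_left _ (by norm_num)
    have h1 : (σ 1 m : ℝ) ≤ (m : ℝ) ^ 2 := by exact_mod_cast ArithmeticFunction.sigma_le_pow_succ 1 m
    nlinarith [(m.cast_nonneg : (0 : ℝ) ≤ m)]

/-- **`E₂(τ) = ∑ₘ e2coef(m) qᵐ`**, `q = e^{2πiτ}` (Mathlib's `hasSum_qExpansion_E2`). [folklore] -/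
theorem E2_eq_discFun {τ : ℂ} (hτ : 0 < im τ) :
    EisensteinSeries.E2 ⟨τ, hτ⟩ = discFun e2coef (cexp (2 * π * I * τ)) := by
  have h := EisensteinSeries.hasSum_qExpansion_E2 (z := ⟨τ, hτ⟩)
  rw [discFun, ← h.tsum_eq]
  refine tsum_congr fun m => ?_
  simp only [e2coef, smul_eq_mul]

/-- `e^{2πiτ} = q̂(τ)²`. [folklore] -/
theorem cexp_two_pi_eq_qhat_sq (τ : ℂ) : cexp (2 * π * I * τ) = qhat τ ^ 2 := by
  rw [qhat, ← Complex.exp_nat_mul]; congr 1; push_cast; ring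

/-- **`η′/η = πi/12 + O(q̂)`** (indeed `+ O(q)`): from `η′/η = (πi/12) E₂` (Mathlib) and the
`q`-expansion of `E₂`. [folklore] -/
theorem isBigOqhat_logDeriv_eta : IsBigOqhat (logDeriv ModularForm.eta) (π * I / 12) := by
  have hsh := norm_shift_le norm_e2coef_le (by norm_num : (0 : ℝ) ≤ 24)
  set M : ℝ := 2 ^ 2 * 24 * (2 : ℕ).factorial / (1 - rexp (-π)) ^ (2 + 1) with hM
  refine ⟨‖π * I / 12‖ * M, 1, fun τ hτ => ?_⟩
  have hτ' : 0 < im τ := by linarith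
  have hq1 : ‖qhat τ‖ < 1 := norm_qhat_lt_one hτ'
  have hqe : ‖qhat τ‖ ≤ rexp (-π) := by
    rw [norm_qhat, Real.exp_le_exp]; nlinarith [Real.pi_pos]
  have hq2 : ‖qhat τ ^ 2‖ ≤ rexp (-π) := by
    rw [norm_pow]
    calc ‖qhat τ‖ ^ 2 ≤ ‖qhat τ‖ ^ 1 := pow_le_pow_of_le_one (norm_nonneg _) hq1.le (by norm_num)
      _ ≤ rexp (-π) := by rw [pow_one]; exact hqe
  have hq2' : ‖qhat τ ^ 2‖ < 1 := by
    rw [norm_pow]; exact pow_lt_one₀ (norm_nonneg _) hq1 two_ne_zero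
  have hE := ModularForm.logDeriv_eta_eq_E2 ⟨τ, hτ'⟩
  have hcoe : ((⟨τ, hτ'⟩ : UpperHalfPlane) : ℂ) = τ := rfl
  rw [hcoe] at hE
  rw [hE, E2_eq_discFun hτ', cexp_two_pi_eq_qhat_sq, discFun_eq_zero_add norm_e2coef_le
    (by norm_num) hq2', show e2coef 0 = 1 by simp [e2coef]]
  have e : π * I / 12 * (1 + qhat τ ^ 2 * discFun (fun n => e2coef (n + 1)) (qhat τ ^ 2)) - π * I / 12 =
      π * I / 12 * (qhat τ ^ 2 * discFun (fun n => e2coef (n + 1)) (qhat τ ^ 2)) := by ring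
  rw [e, norm_mul, norm_mul, mul_assoc]
  apply mul_le_mul_of_nonneg_left _ (norm_nonneg _)
  have hD := norm_discFun_le_of_norm_le_exp hsh (by positivity) hq2
  rw [norm_pow, norm_qhat]
  calc rexp (-(π * im τ)) ^ 2 * ‖discFun (fun n => e2coef (n + 1)) (qhat τ ^ 2)‖
      ≤ rexp (-(π * im τ)) ^ 1 * M := by
        apply mul_le_mul _ hD (norm_nonneg _) (by positivity)
        exact pow_le_pow_of_le_one (Real.exp_pos _).le (by rw [← norm_qhat]; exact hq1.le) (by norm_num)
    _ = M * rexp (-(π * im τ)) := by ring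

end EtaLogDeriv

/-! ### The logarithmic derivative of `f = P′` -/

section BlockLogDeriv

open Literature.NumberTheory.EllipticCurves.JacobiThetaNull

variable {a : ℕ → ℝ} {α : ℝ} {C : ℝ} {m : ℕ} {P : ℝ → ℝ}

/-- **`f′/f = πiα + q̂ · πi H′(q̂)/H(q̂)`** (`f = πi e^{πiατ} H(q̂)`, `H = ∑ aₙ(n+α) wⁿ`), where
`f ≠ 0`. [folklore] -/
theorem logDeriv_blockDer_eq (h : ∀ n : ℕ, |a n| ≤ C * ((n : ℝ) + 1) ^ m) (hC : 0 ≤ C)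
    {τ : ℂ} (hτ : 0 < im τ) (hf : blockDer a α τ ≠ 0) :
    logDeriv (blockDer a α) τ = π * I * α + qhat τ *
      (π * I * deriv (discFun (coefD a α)) (qhat τ) / discFun (coefD a α) (qhat τ)) := by
  have hq : ‖qhat τ‖ < 1 := norm_qhat_lt_one hτ
  have hD0 : discFun (coefD a α) (qhat τ) ≠ 0 := by
    intro h0; apply hf; rw [blockDer, h0, mul_zero]
  have hE0 : π * I * cexp (π * I * α * τ) ≠ 0 :=
    mul_ne_zero (mul_ne_zero (by exact_mod_cast Real.pi_ne_zero) I_ne_zero) (Complex.exp_ne_zero _)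
  have hEd : DifferentiableAt ℂ (fun z : ℂ => π * I * cexp (π * I * α * z)) τ := by
    have : DifferentiableAt ℂ (fun z : ℂ => π * I * α * z) τ := differentiableAt_id.const_mul _
    exact (differentiableAt_const _).mul this.cexp
  have hDd : DifferentiableAt ℂ (fun z => discFun (coefD a α) (qhat z)) τ :=
    (differentiableAt_discFun (norm_coefD_le h hC) (by positivity) hq).comp τ
      (hasDerivAt_qhat τ).differentiableAt
  have e : blockDer a α = fun z => (π * I * cexp (π * I * α * z)) * discFun (coefD a α) (qhat z) := by
    funext z; rw [blockDer]
  rw [e, logDeriv_mul τ hE0 hD0 hEd hDd]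
  -- first factor
  have h1 : logDeriv (fun z : ℂ => π * I * cexp (π * I * α * z)) τ = π * I * α := by
    rw [logDeriv_const_mul τ (π * I) (mul_ne_zero (by exact_mod_cast Real.pi_ne_zero) I_ne_zero),
      logDeriv_apply]
    have hd : HasDerivAt (fun z : ℂ => cexp (π * I * α * z)) (cexp (π * I * α * τ) * (π * I * α)) τ := by
      have : HasDerivAt (fun z : ℂ => π * I * α * z) (π * I * α * 1) τ := (hasDerivAt_id τ).const_mul _
      rw [mul_one] at this
      exact this.cexp
    rw [hd.deriv, mul_div_cancel_left₀ _ (Complex.exp_ne_zero _)]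
  -- second factor
  have h2 : logDeriv (fun z => discFun (coefD a α) (qhat z)) τ =
      qhat τ * (π * I * deriv (discFun (coefD a α)) (qhat τ) / discFun (coefD a α) (qhat τ)) := by
    have hcomp := logDeriv_comp (f := discFun (coefD a α)) (g := qhat) (x := τ)
      (differentiableAt_discFun (norm_coefD_le h hC) (by positivity) hq)
      (hasDerivAt_qhat τ).differentiableAt
    rw [show (fun z => discFun (coefD a α) (qhat z)) = discFun (coefD a α) ∘ qhat from rfl, hcomp,
      (hasDerivAt_qhat τ).deriv, logDeriv_apply]
    ring
  rw [h1, h2]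

/-- **`f′/f = πiα + O(q̂)`** when `f` has no zeros on `ℍ` and `α ≠ 0`. [folklore] -/
theorem isBigOqhat_logDeriv_blockDer (hP : IsConformalBlock P α a)
    (h : ∀ n : ℕ, |a n| ≤ C * ((n : ℝ) + 1) ^ m) (hC : 0 ≤ C) (hα : α ≠ 0)
    (hf : ∀ τ : ℂ, 0 < im τ → blockDer a α τ ≠ 0) :
    IsBigOqhat (logDeriv (blockDer a α)) (π * I * α) := by
  have hcD := norm_coefD_le (α := α) h hC
  have h1 := isBigOqhat_deriv_discFun_qhat hcD (by positivity)
  have h2 := isBigOqhat_discFun_qhat hcD (by positivity)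
  have h0 : coefD a α 0 ≠ 0 := by
    simp only [coefD, Nat.cast_zero, zero_add]
    exact mul_ne_zero (by exact_mod_cast hP.1) (by exact_mod_cast hα)
  have h3 := ((IsBigOqhat.const (π * I)).mul h1).div h2 h0
  have h4 := (IsBigOqhat.const (π * I * α)).add h3.qhat_mul
  rw [add_zero] at h4
  exact h4.congr' fun τ hτ => by rw [logDeriv_blockDer_eq h hC hτ (hf τ hτ)]

/-- Translation by a real number preserves `c₀ + O(q̂)`. [folklore] -/
theorem IsBigOqhat.comp_add_real {F : ℂ → ℂ} {c₀ : ℂ} (hF : IsBigOqhat F c₀) (r : ℝ) :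
    IsBigOqhat (fun τ => F (τ + r)) c₀ := by
  obtain ⟨C, Y, h⟩ := hF
  refine ⟨C, Y, fun τ hτ => ?_⟩
  have := h (τ + r) (by simpa using hτ)
  simpa using this

end BlockLogDeriv

/-! ### The defect `w = f′/f - 4θ₃′/θ₃ - α (λ(1-λ))′/(λ(1-λ))` vanishes -/

section WDefect

open Literature.NumberTheory.EllipticCurves.JacobiThetaNull

/-- `v = (λ(1-λ))′/(λ(1-λ)) = 4θ₂′/θ₂ + 4θ₄′/θ₄ - 8θ₃′/θ₃` (`λ(1-λ) = θ₂⁴θ₄⁴/θ₃⁸`). [folklore] -/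
def vLam (τ : ℂ) : ℂ := 4 * logDeriv theta2 τ + 4 * logDeriv theta4 τ - 8 * logDeriv theta3 τ

/-- The defect `w_f = f′/f - 4θ₃′/θ₃ - α v`, i.e. the logarithmic derivative of
`f / (θ₃⁴ (λ(1-λ))^α)`. [folklore] -/
def wDefect (f : ℂ → ℂ) (α : ℝ) (τ : ℂ) : ℂ := logDeriv f τ - 4 * logDeriv theta3 τ - α * vLam τ

variable {f : ℂ → ℂ} {A : ℂ} {α : ℝ} {τ : ℂ}

/-- `v(τ+1) = 4θ₂′/θ₂ + 4θ₃′/θ₃ - 8θ₄′/θ₄`. [folklore] -/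
theorem vLam_add_one (τ : ℂ) :
    vLam (τ + 1) = 4 * logDeriv theta2 τ + 4 * logDeriv theta3 τ - 8 * logDeriv theta4 τ := by
  rw [vLam, logDeriv_theta2_add_one, logDeriv_theta4_add_one, logDeriv_theta3_add_one]

/-- `v(τ+2) = v(τ)`. [folklore] -/
theorem vLam_add_two (τ : ℂ) : vLam (τ + 2) = vLam τ := by
  rw [show τ + 2 = τ + 1 + 1 by ring, vLam_add_one, logDeriv_theta2_add_one,
    logDeriv_theta3_add_one, logDeriv_theta4_add_one, vLam]

/-- `v(-1/τ) = τ² v(τ)`. [folklore] -/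
theorem vLam_neg_one_div (hτ : 0 < im τ) : vLam (-1 / τ) = τ ^ 2 * vLam τ := by
  rw [vLam, vLam, logDeriv_theta2_neg_one_div hτ, logDeriv_theta4_neg_one_div hτ,
    logDeriv_theta3_neg_one_div hτ]
  ring

/-- `v((τ-1)/τ) = τ² (4θ₄′/θ₄ + 4θ₃′/θ₃ - 8θ₂′/θ₂)(τ)`. [folklore] -/
theorem vLam_TS (hτ : 0 < im τ) :
    vLam ((τ - 1) / τ) =
      τ ^ 2 * (4 * logDeriv theta4 τ + 4 * logDeriv theta3 τ - 8 * logDeriv theta2 τ) := by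
  have hτ0 : τ ≠ 0 := ne_zero_of_im_pos hτ
  have e1 : (τ - 1) / τ = -1 / τ + 1 := by
    rw [div_add' _ _ _ hτ0]
    congr 1
    ring
  rw [e1, vLam_add_one, logDeriv_theta2_neg_one_div hτ, logDeriv_theta4_neg_one_div hτ,
    logDeriv_theta3_neg_one_div hτ]
  ring

/-- `v = πi + O(q̂)`. [folklore] -/
theorem isBigOqhat_vLam : IsBigOqhat vLam (π * I) := by
  have h := ((isBigOqhat_logDeriv_theta2.const_mul 4).add (isBigOqhat_logDeriv_theta4.const_mul 4)).sub
    (isBigOqhat_logDeriv_theta3.const_mul 8)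
  have e : (4 : ℂ) * (π * I / 4) + 4 * 0 - 8 * 0 = π * I := by ring
  rw [e] at h
  exact h

/-- `v` is holomorphic on `ℍ`. [folklore] -/
theorem differentiableAt_vLam (hτ : 0 < im τ) : DifferentiableAt ℂ vLam τ := by
  have h2 := differentiableAt_logDeriv (fun z hz => differentiableAt_theta2 hz) hτ (theta2_ne_zero' hτ)
  have h3 := differentiableAt_logDeriv (fun z hz => differentiableAt_theta3 hz) hτ (theta3_ne_zero' hτ)
  have h4 := differentiableAt_logDeriv (fun z hz => differentiableAt_theta4 hz) hτ (theta4_ne_zero' hτ)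
  unfold vLam
  exact ((h2.const_mul 4).add (h4.const_mul 4)).sub (h3.const_mul 8)

/-- `w(τ+2) = w(τ)`. [folklore] -/
theorem wDefect_add_two (hA : A ≠ 0)
    (hhol : ∀ τ : ℂ, 0 < im τ → DifferentiableAt ℂ f τ)
    (hT2 : ∀ τ : ℂ, 0 < im τ → f (τ + 2) = A * f τ) (hτ : 0 < im τ) :
    wDefect f α (τ + 2) = wDefect f α τ := by
  have h1 := logDeriv_add_law hA (c := 2) hhol (fun z hz => by exact_mod_cast hT2 z hz) hτ
  rw [wDefect, wDefect, vLam_add_two, show (τ : ℂ) + 2 = τ + 1 + 1 by ring,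
    logDeriv_theta3_add_one, logDeriv_theta4_add_one]
  rw [show (τ : ℂ) + 1 + 1 = τ + ((2 : ℝ) : ℂ) by push_cast; ring, h1]

/-- `w(-1/τ) = τ² w(τ)`. [folklore] -/
theorem wDefect_neg_one_div
    (hhol : ∀ τ : ℂ, 0 < im τ → DifferentiableAt ℂ f τ)
    (hS : ∀ τ : ℂ, 0 < im τ → f (-1 / τ) = -τ ^ 2 * f τ)
    (hne : ∀ τ : ℂ, 0 < im τ → f τ ≠ 0) (hτ : 0 < im τ) :
    wDefect f α (-1 / τ) = τ ^ 2 * wDefect f α τ := by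
  have h1 := logDeriv_neg_one_div_law (ε := -1) (by norm_num) hhol
    (fun z hz => by rw [hS z hz]; ring) hτ (hne τ hτ)
  rw [wDefect, wDefect, h1, logDeriv_theta3_neg_one_div hτ, vLam_neg_one_div hτ]
  ring

/-- `w` is holomorphic on `ℍ`. [folklore] -/
theorem differentiableAt_wDefect
    (hhol : ∀ τ : ℂ, 0 < im τ → DifferentiableAt ℂ f τ)
    (hne : ∀ τ : ℂ, 0 < im τ → f τ ≠ 0) (hτ : 0 < im τ) :
    DifferentiableAt ℂ (wDefect f α) τ := by
  have h1 := differentiableAt_logDeriv hhol hτ (hne τ hτ)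
  have h3 := differentiableAt_logDeriv (fun z hz => differentiableAt_theta3 hz) hτ (theta3_ne_zero' hτ)
  unfold wDefect
  exact (h1.sub (h3.const_mul 4)).sub ((differentiableAt_vLam hτ).const_mul _)

/-- `w = O(q̂)`. [folklore] -/
theorem isBigOqhat_wDefect (hℓ : IsBigOqhat (logDeriv f) (π * I * α)) :
    IsBigOqhat (wDefect f α) 0 := by
  have h := (hℓ.sub (isBigOqhat_logDeriv_theta3.const_mul 4)).sub (isBigOqhat_vLam.const_mul (α : ℂ))
  have e : π * I * α - 4 * 0 - α * (π * I) = 0 := by ring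
  rw [e] at h
  exact h

/-- `w(·+1) = O(q̂)`. [folklore] -/
theorem isBigOqhat_wDefect_add_one (hℓ : IsBigOqhat (logDeriv f) (π * I * α)) :
    IsBigOqhat (fun τ => wDefect f α (τ + 1)) 0 := by
  have h1 := hℓ.comp_add_real 1
  have h := (h1.sub (isBigOqhat_logDeriv_theta4.const_mul 4)).sub
    ((((isBigOqhat_logDeriv_theta2.const_mul 4).add (isBigOqhat_logDeriv_theta3.const_mul 4)).sub
      (isBigOqhat_logDeriv_theta4.const_mul 8)).const_mul (α : ℂ))
  have e : π * I * α - 4 * 0 - α * (4 * (π * I / 4) + 4 * 0 - 8 * 0) = 0 := by ring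
  rw [e] at h
  refine h.congr' fun τ _ => ?_
  simp only [wDefect, vLam_add_one, logDeriv_theta3_add_one]
  push_cast
  ring

/-- `(d/dz) ((z-1)/z) = 1/z²`. [folklore] -/
theorem hasDerivAt_moebTS (hτ0 : τ ≠ 0) : HasDerivAt (fun z : ℂ => (z - 1) / z) (1 / τ ^ 2) τ := by
  have h := ((hasDerivAt_id τ).sub_const 1).div (hasDerivAt_id τ) hτ0
  refine h.congr_deriv ?_
  simp only [id]
  field_simp
  ring

/-- `(f ∘ TS)′/(f ∘ TS) = (f′/f)((τ-1)/τ) / τ²`. [folklore] -/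
theorem logDeriv_comp_TS (hhol : ∀ τ : ℂ, 0 < im τ → DifferentiableAt ℂ f τ) (hτ : 0 < im τ) :
    logDeriv (fun z => f ((z - 1) / z)) τ = logDeriv f ((τ - 1) / τ) * (1 / τ ^ 2) := by
  have hτ0 : τ ≠ 0 := ne_zero_of_im_pos hτ
  have hm := hasDerivAt_moebTS hτ0
  have h := logDeriv_comp (f := f) (g := fun z : ℂ => (z - 1) / z) (x := τ)
    (hhol _ (im_sub_one_div_self_pos hτ)) hm.differentiableAt
  rw [show (fun z => f ((z - 1) / z)) = f ∘ fun z : ℂ => (z - 1) / z from rfl, h, hm.deriv]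

/-- **`(f′/f)((τ-1)/τ) / τ² = 2/τ + N′/N - f′/f - (f′/f)(τ+1)`**, from
`f((τ-1)/τ) = τ² N(τ)/(f(τ) f(τ+1))`. [folklore] -/
theorem logDeriv_TS_eq (hhol : ∀ τ : ℂ, 0 < im τ → DifferentiableAt ℂ f τ)
    (hne : ∀ τ : ℂ, 0 < im τ → f τ ≠ 0) (hτ : 0 < im τ) :
    logDeriv f ((τ - 1) / τ) * (1 / τ ^ 2) =
      2 / τ + logDeriv (normTS f) τ - logDeriv f τ - logDeriv f (τ + 1) := by
  have hτ0 : τ ≠ 0 := ne_zero_of_im_pos hτ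
  have hτ1 : 0 < im (τ + 1) := by simpa using hτ
  -- `f((z-1)/z) = z² N(z)/(f(z) f(z+1))` near `τ`
  have hev : (fun z => f ((z - 1) / z)) =ᶠ[𝓝 τ]
      fun z => z ^ 2 * normTS f z / (f z * f (z + 1)) := by
    filter_upwards [isOpen_upperHalfPlaneSet'.mem_nhds hτ] with z hz
    have hz' : 0 < im z := hz
    have hz0 : z ≠ 0 := ne_zero_of_im_pos hz'
    have hf0 := hne z hz'
    have hf1 := hne (z + 1) (by simpa using hz')
    unfold normTS slashTS
    field_simp
  rw [← logDeriv_comp_TS hhol hτ]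
  have hd1 : logDeriv (fun z => f ((z - 1) / z)) τ =
      logDeriv (fun z => z ^ 2 * normTS f z / (f z * f (z + 1))) τ := by
    rw [logDeriv_apply, logDeriv_apply, hev.deriv_eq, hev.eq_of_nhds]
  rw [hd1]
  -- now compute the logarithmic derivative of the quotient
  have hN0 : normTS f τ ≠ 0 := by
    unfold normTS slashTS
    exact mul_ne_zero (mul_ne_zero (hne τ hτ) (hne _ hτ1))
      (mul_ne_zero (inv_ne_zero (pow_ne_zero 2 hτ0)) (hne _ (im_sub_one_div_self_pos hτ)))
  have hNd : DifferentiableAt ℂ (normTS f) τ := differentiableAt_normTS hhol hτ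
  have hsq : DifferentiableAt ℂ (fun z : ℂ => z ^ 2) τ := differentiableAt_pow 2
  have hnum0 : τ ^ 2 * normTS f τ ≠ 0 := mul_ne_zero (pow_ne_zero 2 hτ0) hN0
  have hnumd : DifferentiableAt ℂ (fun z : ℂ => z ^ 2 * normTS f z) τ := hsq.mul hNd
  have hf1d : DifferentiableAt ℂ (fun z => f (z + 1)) τ :=
    (hhol _ hτ1).comp τ (differentiableAt_id.add_const 1)
  have hden0 : f τ * f (τ + 1) ≠ 0 := mul_ne_zero (hne τ hτ) (hne _ hτ1)
  have hdend : DifferentiableAt ℂ (fun z => f z * f (z + 1)) τ := (hhol τ hτ).mul hf1d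
  rw [logDeriv_div τ hnum0 hden0 hnumd hdend,
    logDeriv_mul (f := fun z : ℂ => z ^ 2) (g := normTS f) τ (pow_ne_zero 2 hτ0) hN0 hsq hNd,
    logDeriv_mul (f := f) (g := fun z => f (z + 1)) τ (hne τ hτ) (hne _ hτ1) (hhol τ hτ) hf1d]
  have h1 : logDeriv (fun z : ℂ => z ^ 2) τ = 2 / τ := by
    rw [show (fun z : ℂ => z ^ 2) = (· ^ 2) from rfl, logDeriv_pow]
    push_cast
    ring
  have h2 : logDeriv (fun z => f (z + 1)) τ = logDeriv f (τ + 1) := by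
    rw [logDeriv_apply, logDeriv_apply, deriv_comp_add_const f 1 τ]
  rw [h1, h2]
  ring

/-- **`(w|₂TS)(τ) = N′/N - f′/f - (f′/f)(τ+1) - 4θ₂′/θ₂ - α(4θ₄′/θ₄ + 4θ₃′/θ₃ - 8θ₂′/θ₂)`.**
[folklore] -/
theorem slashTS_wDefect (hhol : ∀ τ : ℂ, 0 < im τ → DifferentiableAt ℂ f τ)
    (hne : ∀ τ : ℂ, 0 < im τ → f τ ≠ 0) (hτ : 0 < im τ) :
    slashTS (wDefect f α) τ = logDeriv (normTS f) τ - logDeriv f τ - logDeriv f (τ + 1) -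
      4 * logDeriv theta2 τ -
      α * (4 * logDeriv theta4 τ + 4 * logDeriv theta3 τ - 8 * logDeriv theta2 τ) := by
  have hτ0 : τ ≠ 0 := ne_zero_of_im_pos hτ
  have key := logDeriv_TS_eq hhol hne hτ
  have e1 : (τ - 1) / τ = -1 / τ + 1 := by
    rw [div_add' _ _ _ hτ0]
    congr 1
    ring
  have hL3 : logDeriv theta3 ((τ - 1) / τ) = τ ^ 2 * logDeriv theta2 τ + τ / 2 := by
    rw [e1, logDeriv_theta3_add_one, logDeriv_theta4_neg_one_div hτ]
  unfold slashTS wDefect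
  rw [hL3, vLam_TS hτ]
  have key' : logDeriv f ((τ - 1) / τ) =
      τ ^ 2 * (2 / τ + logDeriv (normTS f) τ - logDeriv f τ - logDeriv f (τ + 1)) := by
    have := congrArg (· * τ ^ 2) key
    rw [one_div, inv_mul_cancel_right₀ (pow_ne_zero 2 hτ0)] at this
    rw [this, mul_comm]
  rw [key']
  field_simp
  ring

/-- `w|₂TS = O(q̂)`. [folklore] -/
theorem isBigOqhat_slashTS_wDefect (hhol : ∀ τ : ℂ, 0 < im τ → DifferentiableAt ℂ f τ)
    (hne : ∀ τ : ℂ, 0 < im τ → f τ ≠ 0) (hℓ : IsBigOqhat (logDeriv f) (π * I * α))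
    (hN : IsBigOqhat (logDeriv (normTS f)) (π * I)) :
    IsBigOqhat (slashTS (wDefect f α)) 0 := by
  have h := (((hN.sub hℓ).sub (hℓ.comp_add_real 1)).sub (isBigOqhat_logDeriv_theta2.const_mul 4)).sub
    ((((isBigOqhat_logDeriv_theta4.const_mul 4).add (isBigOqhat_logDeriv_theta3.const_mul 4)).sub
      (isBigOqhat_logDeriv_theta2.const_mul 8)).const_mul (α : ℂ))
  have e : π * I - π * I * α - π * I * α - 4 * (π * I / 4) - α * (4 * 0 + 4 * 0 - 8 * (π * I / 4)) = 0 := by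
    ring
  rw [e] at h
  refine h.congr' fun τ hτ => ?_
  rw [slashTS_wDefect hhol hne hτ]
  push_cast
  ring

/-- **`w = 0` on `ℍ`**: `w` is holomorphic, `w(τ+2) = w(τ)`, `w(-1/τ) = τ² w(τ)`, and
`N(w) = w · w(·+1) · (w|₂TS) = O(q̂³) → 0`, so `N(w) ∈ S₆(SL₂(ℤ)) = 0` (`eq_zero_plus`). In the
printed proof this is the comparison of `f₁` with the right-hand side of (pihpr): "these two
functions must be proportional". [cite: KlebanZagier2003, §5 (proof of Theorem 2)] -/
theorem wDefect_eq_zero (hA : A ≠ 0)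
    (hhol : ∀ τ : ℂ, 0 < im τ → DifferentiableAt ℂ f τ)
    (hT2 : ∀ τ : ℂ, 0 < im τ → f (τ + 2) = A * f τ)
    (hS : ∀ τ : ℂ, 0 < im τ → f (-1 / τ) = -τ ^ 2 * f τ)
    (hne : ∀ τ : ℂ, 0 < im τ → f τ ≠ 0)
    (hℓ : IsBigOqhat (logDeriv f) (π * I * α))
    (hN : IsBigOqhat (logDeriv (normTS f)) (π * I)) (hτ : 0 < im τ) :
    wDefect f α τ = 0 := by
  obtain ⟨C₁, Y₁, hC₁, hY₁, h₁⟩ := (isBigOqhat_wDefect hℓ).bound'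
  obtain ⟨C₂, Y₂, hC₂, hY₂, h₂⟩ := (isBigOqhat_wDefect_add_one hℓ).bound'
  obtain ⟨C₃, Y₃, hC₃, hY₃, h₃⟩ := (isBigOqhat_slashTS_wDefect hhol hne hℓ hN).bound'
  set Y : ℝ := max Y₁ (max Y₂ Y₃) with hY
  have hYpos : 0 < Y := lt_of_lt_of_le hY₁ (le_max_left _ _)
  have hNw : ∀ σ : ℂ, Y ≤ im σ → ‖normTS (wDefect f α) σ‖ ≤ C₁ * C₂ * C₃ * rexp (-(3 * π * im σ)) := by
    intro σ hσ
    have hσ1 : Y₁ ≤ im σ := le_trans (le_max_left _ _) hσ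
    have hσ2 : Y₂ ≤ im σ := le_trans (le_trans (le_max_left _ _) (le_max_right _ _)) hσ
    have hσ3 : Y₃ ≤ im σ := le_trans (le_trans (le_max_right _ _) (le_max_right _ _)) hσ
    have b1 := h₁ σ hσ1
    have b2 := h₂ σ hσ2
    have b3 := h₃ σ hσ3
    rw [sub_zero] at b1 b2 b3
    rw [normTS, norm_mul, norm_mul]
    have e3 : rexp (-(3 * π * im σ)) = rexp (-(π * im σ)) * rexp (-(π * im σ)) * rexp (-(π * im σ)) := by
      rw [← Real.exp_add, ← Real.exp_add]; ring_nf
    rw [e3]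
    calc ‖wDefect f α σ‖ * ‖wDefect f α (σ + 1)‖ * ‖slashTS (wDefect f α) σ‖
        ≤ C₁ * rexp (-(π * im σ)) * (C₂ * rexp (-(π * im σ))) * (C₃ * rexp (-(π * im σ))) :=
          mul_le_mul (mul_le_mul b1 b2 (norm_nonneg _) (by positivity)) b3 (norm_nonneg _)
            (by positivity)
      _ = _ := by ring
  have hB : Tendsto (fun y : ℝ => C₁ * C₂ * C₃ * rexp (-(3 * π * y))) atTop (𝓝 0) := by
    have ht : Tendsto (fun y : ℝ => C₁ * C₂ * C₃ * rexp (-(3 * π * y))) atTop (𝓝 (C₁ * C₂ * C₃ * 0)) := by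
      refine (Real.tendsto_exp_atBot.comp ?_).const_mul _
      exact tendsto_neg_atTop_atBot.comp (tendsto_id.const_mul_atTop (by positivity))
    rwa [mul_zero] at ht
  exact eq_zero_plus (f := wDefect f α) (A := 1) one_ne_zero
    (fun z hz => differentiableAt_wDefect hhol hne hz)
    (fun z hz => by rw [wDefect_add_two hA hhol hT2 hz, one_mul])
    (fun z hz => wDefect_neg_one_div hhol hS hne hz) hB hYpos
    (fun σ hσ _ _ => hNw σ hσ) hτ

end WDefect

/-! ### The data of Theorem 2 packaged: `f = P′` is zero-free and `N(f)² = c η²⁴` -/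

section Package

variable {a : ℕ → ℝ} {α : ℝ} {C : ℝ} {m : ℕ} {P : ℝ → ℝ}

/-- Under the hypotheses of Theorem 2 (with `Π₁` non-constant), `f = P′` has no zeros on `ℍ` and
`N(f)² = c η²⁴` with `c ≠ 0`. [cite: KlebanZagier2003, §5 (proof of Theorem 2)] -/
theorem blockDer_package (hP : IsConformalBlock P α a)
    (h : ∀ n : ℕ, |a n| ≤ C * ((n : ℝ) + 1) ^ m) (hC : 0 ≤ C)
    (hdual : ∀ r : ℝ, 0 < r → P (1 / r) = 1 - P r)
    (hnc : ∃ r s : ℝ, 0 < r ∧ 0 < s ∧ P r ≠ P s) (hα : 0 < α) :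
    (∀ τ : ℂ, 0 < im τ → blockDer a α τ ≠ 0) ∧
    ∃ c : ℂ, c ≠ 0 ∧ ∀ (τ : ℂ) (_ : 0 < im τ),
      normTS (blockDer a α) τ ^ 2 = c * ModularForm.eta τ ^ 24 := by
  have hf : ∃ τ : ℂ, 0 < im τ ∧ blockDer a α τ ≠ 0 := exists_blockDer_ne_zero hP h hC hnc
  have hA : cexp (2 * π * I * α) ≠ 0 := Complex.exp_ne_zero _
  have hhol : ∀ τ : ℂ, 0 < im τ → DifferentiableAt ℂ (blockDer a α) τ :=
    fun τ hτ => differentiableAt_blockDer h hC hτ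
  have hT2 : ∀ τ : ℂ, 0 < im τ → blockDer a α (τ + 2) = cexp (2 * π * I * α) * blockDer a α τ :=
    fun τ _ => blockDer_add_two τ
  have hS : ∀ τ : ℂ, 0 < im τ → blockDer a α (-1 / τ) = -τ ^ 2 * blockDer a α τ :=
    fun τ hτ => blockDer_neg_one_div hP h hC hdual hτ
  set K : ℝ := π * rexp (π * |α|) * (C * (1 + |α|) * (m + 1).factorial * 2 ^ (m + 2)) with hK
  have hgr' : ∀ τ : ℂ, 0 < im τ → im τ ≤ 1 → ‖blockDer a α τ‖ ≤ K * (im τ)⁻¹ ^ (m + 2) := by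
    intro τ hτ hτ1
    have := norm_blockDer_le_of_im_le_one (α := α) h hC hτ hτ1
    rwa [inv_pow, ← div_eq_mul_inv]
  set M : ℝ := π * (C * (1 + |α|) * (m + 1).factorial / (1 - rexp (-π)) ^ (m + 2)) with hM
  have hdec : ∀ τ : ℂ, 1 ≤ im τ → ‖blockDer a α τ‖ ≤ M * rexp (-(π * α * im τ)) :=
    fun τ hτ => norm_blockDer_le_of_one_le_im h hC hτ
  obtain ⟨c, hc⟩ := normTS_sq_eq_mul_discriminant (β := π * α) hA hhol hT2 hS (by positivity) hdec hgr'
  obtain ⟨τ₁, hτ₁, hN₁⟩ := exists_normTS_ne_zero hhol hf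
  have hc0 : c ≠ 0 := by
    intro h0
    apply hN₁
    have := hc τ₁ hτ₁
    rw [h0, zero_mul] at this
    exact pow_eq_zero_iff two_ne_zero |>.mp this
  have hc' : ∀ (τ : ℂ) (hτ : 0 < im τ), normTS (blockDer a α) τ ^ 2 = c * ModularForm.eta τ ^ 24 :=
    fun τ hτ => hc τ hτ
  refine ⟨fun τ hτ hf0 => ?_, c, hc0, hc'⟩
  have hN : normTS (blockDer a α) τ = 0 := by rw [normTS, hf0, zero_mul, zero_mul]
  have := hc' τ hτ
  rw [hN] at this
  have hη : ModularForm.eta τ ≠ 0 := ModularForm.eta_ne_zero hτ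
  exact (mul_ne_zero hc0 (pow_ne_zero 24 hη)) (by simpa using this.symm)

/-- **`N′/N = 12 η′/η = πi + O(q̂)`** when `N² = c η²⁴`. [folklore] -/
theorem isBigOqhat_logDeriv_normTS {f : ℂ → ℂ}
    (hhol : ∀ τ : ℂ, 0 < im τ → DifferentiableAt ℂ f τ) {c : ℂ} (hc : c ≠ 0)
    (hN : ∀ (τ : ℂ) (_ : 0 < im τ), normTS f τ ^ 2 = c * ModularForm.eta τ ^ 24) :
    IsBigOqhat (logDeriv (normTS f)) (π * I) := by
  have h12 := isBigOqhat_logDeriv_eta.const_mul 12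
  rw [show (12 : ℂ) * (π * I / 12) = π * I by ring] at h12
  refine h12.congr' fun τ hτ => ?_
  have hη0 : ModularForm.eta τ ≠ 0 := ModularForm.eta_ne_zero hτ
  have hηd : DifferentiableAt ℂ ModularForm.eta τ :=
    ModularForm.differentiableAt_eta_of_mem_upperHalfPlaneSet hτ
  have hN0 : normTS f τ ≠ 0 := by
    intro h0
    have := hN τ hτ
    rw [h0] at this
    exact (mul_ne_zero hc (pow_ne_zero 24 hη0)) (by simpa using this.symm)
  have hNd := differentiableAt_normTS hhol hτ
  have hev : (fun z => normTS f z ^ 2) =ᶠ[𝓝 τ] fun z => c * ModularForm.eta z ^ 24 := by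
    filter_upwards [isOpen_upperHalfPlaneSet'.mem_nhds hτ] with z hz using hN z hz
  have h1 : logDeriv (fun z => normTS f z ^ 2) τ = logDeriv (fun z => c * ModularForm.eta z ^ 24) τ := by
    rw [logDeriv_apply, logDeriv_apply, hev.deriv_eq, hev.eq_of_nhds]
  rw [logDeriv_fun_pow hNd 2, logDeriv_const_mul τ c hc, logDeriv_fun_pow hηd 24] at h1
  push_cast at h1
  linear_combination (-1 / 2 : ℂ) * h1

end Package

/-! ### On the imaginary axis: `f(it) = K · θ₃(it)⁴ · (λ(1-λ))^α(it)` -/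

section Axis

open Literature.NumberTheory.EllipticCurves.JacobiThetaNull

variable {t : ℝ}

/-- The path `t ↦ it` has derivative `i`. [folklore] -/
theorem hasDerivAt_I_mul (t : ℝ) : HasDerivAt (fun s : ℝ => (I * s : ℂ)) I t := by
  have h := ((hasDerivAt_id t).ofReal_comp).const_mul I
  simpa using h

/-- A real-valued path in `ℂ` has real derivative. [folklore] -/
theorem im_eq_zero_of_hasDerivAt {φ : ℝ → ℂ} {D : ℂ} (hφ : HasDerivAt φ D t)
    (hreal : ∀ᶠ s in 𝓝 t, (φ s).im = 0) : D.im = 0 := by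
  have h1 : HasDerivAt (fun s => (φ s).im) D.im t :=
    (Complex.imCLM.hasFDerivAt.comp t hφ.hasFDerivAt).hasDerivAt.congr_deriv (by simp)
  have h2 : HasDerivAt (fun s => (φ s).im) 0 t :=
    (hasDerivAt_const t (0 : ℝ)).congr_of_eventuallyEq hreal
  exact h1.unique h2

/-- The real part of a path in `ℂ` has the expected derivative. [folklore] -/
theorem hasDerivAt_re_of_real {φ : ℝ → ℂ} {D : ℂ} (hφ : HasDerivAt φ D t) :
    HasDerivAt (fun s => (φ s).re) D.re t :=
  (Complex.reCLM.hasFDerivAt.comp t hφ.hasFDerivAt).hasDerivAt.congr_deriv (by simp)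

/-- `ρ = λ(1-λ) = θ₂⁴θ₄⁴/θ₃⁸` as a function on `ℂ`. [folklore] -/
def rhoC (τ : ℂ) : ℂ := theta2 τ ^ 4 * theta4 τ ^ 4 / theta3 τ ^ 8

/-- `ρ ≠ 0` on `ℍ`. [folklore] -/
theorem rhoC_ne_zero {τ : ℂ} (hτ : 0 < im τ) : rhoC τ ≠ 0 :=
  div_ne_zero (mul_ne_zero (pow_ne_zero 4 (theta2_ne_zero' hτ)) (pow_ne_zero 4 (theta4_ne_zero' hτ)))
    (pow_ne_zero 8 (theta3_ne_zero' hτ))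

/-- `ρ` is holomorphic on `ℍ`. [folklore] -/
theorem differentiableAt_rhoC {τ : ℂ} (hτ : 0 < im τ) : DifferentiableAt ℂ rhoC τ := by
  unfold rhoC
  exact (((differentiableAt_theta2 hτ).pow 4).mul ((differentiableAt_theta4 hτ).pow 4)).div
    ((differentiableAt_theta3 hτ).pow 8) (pow_ne_zero 8 (theta3_ne_zero' hτ))

/-- **`ρ′/ρ = v = 4θ₂′/θ₂ + 4θ₄′/θ₄ - 8θ₃′/θ₃`.** [folklore] -/
theorem logDeriv_rhoC {τ : ℂ} (hτ : 0 < im τ) : logDeriv rhoC τ = vLam τ := by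
  have h2 := theta2_ne_zero' hτ
  have h3 := theta3_ne_zero' hτ
  have h4 := theta4_ne_zero' hτ
  have d2 := differentiableAt_theta2 hτ
  have d3 := differentiableAt_theta3 hτ
  have d4 := differentiableAt_theta4 hτ
  rw [show rhoC = fun z => theta2 z ^ 4 * theta4 z ^ 4 / theta3 z ^ 8 from rfl,
    logDeriv_div (f := fun z => theta2 z ^ 4 * theta4 z ^ 4) (g := fun z => theta3 z ^ 8) τ
      (mul_ne_zero (pow_ne_zero 4 h2) (pow_ne_zero 4 h4)) (pow_ne_zero 8 h3)
      ((d2.pow 4).mul (d4.pow 4)) (d3.pow 8),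
    logDeriv_mul (f := fun z => theta2 z ^ 4) (g := fun z => theta4 z ^ 4) τ (pow_ne_zero 4 h2)
      (pow_ne_zero 4 h4) (d2.pow 4) (d4.pow 4),
    logDeriv_fun_pow d2 4, logDeriv_fun_pow d4 4, logDeriv_fun_pow d3 8, vLam]
  push_cast
  ring

/-- `(d/dτ) ρ = ρ v`. [folklore] -/
theorem hasDerivAt_rhoC {τ : ℂ} (hτ : 0 < im τ) : HasDerivAt rhoC (rhoC τ * vLam τ) τ := by
  have hd := (differentiableAt_rhoC hτ).hasDerivAt
  have e : deriv rhoC τ = rhoC τ * vLam τ := by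
    rw [← logDeriv_rhoC hτ, logDeriv_apply, mul_div_cancel₀ _ (rhoC_ne_zero hτ)]
  rwa [e] at hd

/-- `θ₃(it)` is the real number `(θ₃(it)).re`, and similarly for `ρ(it)`. [folklore] -/
theorem rhoC_I_mul_eq_re (ht : 0 < t) : rhoC (I * t) = ((rhoC (I * t)).re : ℂ) := by
  conv_lhs => rw [rhoC, theta2_I_mul_eq_re ht, theta3_I_mul_eq_re ht, theta4_I_mul_eq_re ht]
  conv_rhs => rw [rhoC, theta2_I_mul_eq_re ht, theta3_I_mul_eq_re ht, theta4_I_mul_eq_re ht]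
  norm_cast

/-- `ρ(it) > 0`. [folklore] -/
theorem rhoC_I_mul_re_pos (ht : 0 < t) : 0 < (rhoC (I * t)).re := by
  rw [rhoC, theta2_I_mul_eq_re ht, theta3_I_mul_eq_re ht, theta4_I_mul_eq_re ht]
  have h2 := theta2_I_mul_re_pos ht
  have h3 := theta3_I_mul_re_pos ht
  have h4 := theta4_I_mul_re_pos ht
  norm_cast
  positivity

/-- `ρ` along the axis as a real function. [folklore] -/
def rhoR (t : ℝ) : ℝ := (rhoC (I * t)).re

/-- **`(d/dt) ρ(it) = ρ(it) · (i v(it))`**, and `i v(it)` is real. [folklore] -/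
theorem hasDerivAt_rhoR (ht : 0 < t) :
    HasDerivAt rhoR (rhoR t * (I * vLam (I * t)).re) t ∧ (I * vLam (I * t)).im = 0 := by
  have him : 0 < im (I * t : ℂ) := by simpa using ht
  have hc : HasDerivAt (rhoC ∘ fun s : ℝ => (I * s : ℂ)) (rhoC (I * t) * vLam (I * t) * I) t :=
    HasDerivAt.comp t (by exact hasDerivAt_rhoC him) (hasDerivAt_I_mul t)
  have hreal : ∀ᶠ s : ℝ in 𝓝 t, ((rhoC ∘ fun s : ℝ => (I * s : ℂ)) s).im = 0 := by
    filter_upwards [isOpen_Ioi.mem_nhds (Set.mem_Ioi.mpr ht)] with s hs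
    rw [Function.comp_apply, rhoC_I_mul_eq_re (Set.mem_Ioi.mp hs), Complex.ofReal_im]
  have hD := im_eq_zero_of_hasDerivAt hc hreal
  have hρ : rhoC (I * t) = (rhoR t : ℂ) := rhoC_I_mul_eq_re ht
  have e0 : rhoC (I * t) * vLam (I * t) * I = (rhoR t : ℂ) * (I * vLam (I * t)) := by
    rw [hρ]; ring
  have hvreal : (I * vLam (I * t)).im = 0 := by
    rw [e0, Complex.im_ofReal_mul] at hD
    rcases mul_eq_zero.mp hD with h0 | h0
    · exact absurd h0 (rhoC_I_mul_re_pos ht).ne'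
    · exact h0
  refine ⟨?_, hvreal⟩
  have hre := hasDerivAt_re_of_real hc
  rw [e0, Complex.re_ofReal_mul] at hre
  exact hre

/-- `θ₃(it)` along the axis: `(d/dt) θ₃(it)⁴ = θ₃(it)⁴ · 4 θ₃′/θ₃(it) · i`. [folklore] -/
theorem hasDerivAt_theta3_pow_four_axis (ht : 0 < t) :
    HasDerivAt (fun s : ℝ => theta3 (I * s) ^ 4)
      (theta3 (I * t) ^ 4 * (4 * logDeriv theta3 (I * t) * I)) t := by
  have him : 0 < im (I * t : ℂ) := by simpa using ht
  have h3 := theta3_ne_zero' him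
  have hd : HasDerivAt theta3 (deriv theta3 (I * t)) (I * t) := (differentiableAt_theta3 him).hasDerivAt
  have hc : HasDerivAt (theta3 ∘ fun s : ℝ => (I * s : ℂ)) (deriv theta3 (I * t) * I) t :=
    HasDerivAt.comp t (by exact hd) (hasDerivAt_I_mul t)
  have hp := hc.pow 4
  refine hp.congr_deriv ?_
  simp only [Function.comp_apply, logDeriv_apply]
  field_simp
  push_cast
  ring

variable {a : ℕ → ℝ} {α : ℝ} {C : ℝ} {m : ℕ} {P : ℝ → ℝ}

/-- The model solution on the axis, `Ψ(t) = θ₃(it)⁴ · ρ(it)^α` (real power of the positive real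
`ρ(it) = λ(1-λ)`). [folklore] -/
def psiAxis (α : ℝ) (t : ℝ) : ℂ := theta3 (I * t) ^ 4 * ((rhoR t ^ α : ℝ) : ℂ)

/-- `Ψ ≠ 0`. [folklore] -/
theorem psiAxis_ne_zero (ht : 0 < t) : psiAxis α t ≠ 0 := by
  have him : 0 < im (I * t : ℂ) := by simpa using ht
  refine mul_ne_zero (pow_ne_zero 4 (theta3_ne_zero' him)) ?_
  exact_mod_cast (Real.rpow_pos_of_pos (rhoC_I_mul_re_pos ht) α).ne'

/-- **`Ψ′ = Ψ · i (4θ₃′/θ₃ + α v)(it)`.** [folklore] -/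
theorem hasDerivAt_psiAxis (ht : 0 < t) :
    HasDerivAt (psiAxis α)
      (psiAxis α t * ((4 * logDeriv theta3 (I * t) + α * vLam (I * t)) * I)) t := by
  obtain ⟨hR, hvreal⟩ := hasDerivAt_rhoR ht
  have hRpos : 0 < rhoR t := rhoC_I_mul_re_pos ht
  -- real power
  have hpow : HasDerivAt (fun s => rhoR s ^ α) (α * rhoR t ^ α * (I * vLam (I * t)).re) t := by
    have h := (Real.hasDerivAt_rpow_const (p := α) (Or.inl hRpos.ne')).comp t hR
    refine h.congr_deriv ?_
    rw [Real.rpow_sub_one hRpos.ne']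
    field_simp
  have hpowC : HasDerivAt (fun s => ((rhoR s ^ α : ℝ) : ℂ))
      (((α * rhoR t ^ α * (I * vLam (I * t)).re : ℝ) : ℂ)) t := hpow.ofReal_comp
  have hθ := hasDerivAt_theta3_pow_four_axis ht
  have hprod := hθ.mul hpowC
  refine hprod.congr_deriv ?_
  have hv : (((I * vLam (I * t)).re : ℝ) : ℂ) = I * vLam (I * t) := by
    conv_rhs => rw [← Complex.re_add_im (I * vLam (I * t)), hvreal]
    simp
  simp only [psiAxis]
  push_cast
  rw [hv]
  ring

/-- **`f(it) = K Ψ(t)` on the positive axis**, for some constant `K`: both `t ↦ f(it)` and `Ψ`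
satisfy `y′ = i (f′/f)(it) y` since `w = 0`, so their ratio has zero derivative on `(0, ∞)`.
[cite: KlebanZagier2003, §5 (proof of Theorem 2)] -/
theorem exists_blockDer_axis_eq (hP : IsConformalBlock P α a)
    (h : ∀ n : ℕ, |a n| ≤ C * ((n : ℝ) + 1) ^ m) (hC : 0 ≤ C)
    (hdual : ∀ r : ℝ, 0 < r → P (1 / r) = 1 - P r)
    (hnc : ∃ r s : ℝ, 0 < r ∧ 0 < s ∧ P r ≠ P s) (hα : 0 < α) :
    ∃ K : ℂ, ∀ t : ℝ, 0 < t → blockDer a α (I * t) = K * psiAxis α t := by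
  obtain ⟨hne, c, hc0, hN⟩ := blockDer_package hP h hC hdual hnc hα
  have hA : cexp (2 * π * I * α) ≠ 0 := Complex.exp_ne_zero _
  have hhol : ∀ τ : ℂ, 0 < im τ → DifferentiableAt ℂ (blockDer a α) τ :=
    fun τ hτ => differentiableAt_blockDer h hC hτ
  have hT2 : ∀ τ : ℂ, 0 < im τ → blockDer a α (τ + 2) = cexp (2 * π * I * α) * blockDer a α τ :=
    fun τ _ => blockDer_add_two τ
  have hS : ∀ τ : ℂ, 0 < im τ → blockDer a α (-1 / τ) = -τ ^ 2 * blockDer a α τ :=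
    fun τ hτ => blockDer_neg_one_div hP h hC hdual hτ
  have hℓ := isBigOqhat_logDeriv_blockDer hP h hC hα.ne' hne
  have hNℓ := isBigOqhat_logDeriv_normTS hhol hc0 hN
  have hw : ∀ τ : ℂ, 0 < im τ → wDefect (blockDer a α) α τ = 0 :=
    fun τ hτ => wDefect_eq_zero hA hhol hT2 hS hne hℓ hNℓ hτ
  -- the ratio `Φ/Ψ` has zero derivative on `(0, ∞)`
  set Φ : ℝ → ℂ := fun s => blockDer a α (I * s) with hΦ
  set H : ℝ → ℂ := fun s => Φ s / psiAxis α s with hH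
  have hderiv : ∀ t : ℝ, 0 < t → HasDerivAt H 0 t := by
    intro t ht
    have him : 0 < im (I * t : ℂ) := by simpa using ht
    have hf0 := hne _ him
    have hdΦ : HasDerivAt Φ (Φ t * (logDeriv (blockDer a α) (I * t) * I)) t := by
      have hd : HasDerivAt (blockDer a α) (deriv (blockDer a α) (I * t)) (I * t) :=
        (hhol _ him).hasDerivAt
      have hc : HasDerivAt (blockDer a α ∘ fun s : ℝ => (I * s : ℂ))
          (deriv (blockDer a α) (I * t) * I) t := HasDerivAt.comp t (by exact hd) (hasDerivAt_I_mul t)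
      refine hc.congr_deriv ?_
      rw [hΦ, logDeriv_apply]
      field_simp
    have hdΨ := hasDerivAt_psiAxis (α := α) ht
    have hcoef : logDeriv (blockDer a α) (I * t) = 4 * logDeriv theta3 (I * t) + α * vLam (I * t) := by
      have := hw _ him
      rw [wDefect] at this
      linear_combination this
    have hΨ0 := psiAxis_ne_zero (α := α) ht
    have hq := hdΦ.div hdΨ hΨ0
    refine hq.congr_deriv ?_
    rw [hcoef]
    field_simp
    ring
  have hdiff : DifferentiableOn ℝ H (Set.Ioi 0) := fun t ht => (hderiv t ht).differentiableAt.differentiableWithinAt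
  have hder0 : Set.EqOn (deriv H) 0 (Set.Ioi 0) := fun t ht => (hderiv t ht).deriv
  refine ⟨H 1, fun t ht => ?_⟩
  have key := isOpen_Ioi.is_const_of_deriv_eq_zero (convex_Ioi (0 : ℝ)).isPreconnected hdiff hder0
    ht (Set.mem_Ioi.mpr one_pos)
  -- key : H t = H 1
  have hΨ0 := psiAxis_ne_zero (α := α) ht
  have : Φ t = H t * psiAxis α t := by rw [hH]; field_simp
  show Φ t = H 1 * psiAxis α t
  rw [this, key]

end Axis

/-! ### The elliptic modulus on the axis -/

section LambdaAxis

open Literature.NumberTheory.EllipticCurves.JacobiThetaNull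

variable {t : ℝ}

/-- `λ(it) = θ₂(it)⁴/θ₃(it)⁴` as a real number. [folklore] -/
def lamR (t : ℝ) : ℝ := (theta2 (I * t)).re ^ 4 / (theta3 (I * t)).re ^ 4

/-- `λ = θ₂⁴/θ₃⁴` as a function on `ℂ`. [folklore] -/
def lamC (τ : ℂ) : ℂ := theta2 τ ^ 4 / theta3 τ ^ 4

/-- `λ(it) ∈ (0, 1)`. [folklore] -/
theorem lamR_mem_Ioo (ht : 0 < t) : lamR t ∈ Set.Ioo (0 : ℝ) 1 :=
  theta2_div_theta3_pow_four_mem_Ioo ht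

/-- `1 - λ(it) = θ₄(it)⁴/θ₃(it)⁴` (Jacobi's quartic identity). [folklore] -/
theorem one_sub_lamR (ht : 0 < t) : 1 - lamR t = (theta4 (I * t)).re ^ 4 / (theta3 (I * t)).re ^ 4 := by
  have h3 := pow_pos (theta3_I_mul_re_pos ht) 4
  rw [lamR, eq_div_iff h3.ne', sub_mul, div_mul_cancel₀ _ h3.ne', theta3_I_mul_re_pow_four ht]
  ring

/-- `ρ(it) = λ(1-λ)(it)`. [folklore] -/
theorem rhoR_eq (ht : 0 < t) : rhoR t = lamR t * (1 - lamR t) := by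
  have h3 := pow_pos (theta3_I_mul_re_pos ht) 4
  rw [one_sub_lamR ht, lamR, rhoR, rhoC, theta2_I_mul_eq_re ht, theta3_I_mul_eq_re ht,
    theta4_I_mul_eq_re ht]
  norm_cast
  field_simp

/-- `λ(it)` as a complex number. [folklore] -/
theorem lamC_I_mul (ht : 0 < t) : lamC (I * t) = (lamR t : ℂ) := by
  rw [lamC, lamR, theta2_I_mul_eq_re ht, theta3_I_mul_eq_re ht]
  norm_cast

/-- The tree's `modularLambdaI` is `lamR`. [folklore] -/
theorem modularLambdaI_eq_lamR (ht : 0 < t) : modularLambdaI t = lamR t := by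
  rw [modularLambdaI, div_pow, ← lamC, lamC_I_mul ht, Complex.ofReal_re]

/-- `λ ≠ 0` and holomorphic on `ℍ`, with `λ′ = πi θ₄⁴ λ`. [cite: KlebanZagier2003, §3] -/
theorem hasDerivAt_lamC {τ : ℂ} (hτ : 0 < im τ) :
    HasDerivAt lamC (lamC τ * (π * I * theta4 τ ^ 4)) τ := by
  have h2 := theta2_ne_zero' hτ
  have h3 := theta3_ne_zero' hτ
  have d2 := differentiableAt_theta2 hτ
  have d3 := differentiableAt_theta3 hτ
  have hd : DifferentiableAt ℂ lamC τ := by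
    unfold lamC; exact (d2.pow 4).div (d3.pow 4) (pow_ne_zero 4 h3)
  have hl0 : lamC τ ≠ 0 := div_ne_zero (pow_ne_zero 4 h2) (pow_ne_zero 4 h3)
  have hlog : logDeriv lamC τ = π * I * theta4 τ ^ 4 := by
    rw [show lamC = fun z => theta2 z ^ 4 / theta3 z ^ 4 from rfl,
      logDeriv_div (f := fun z => theta2 z ^ 4) (g := fun z => theta3 z ^ 4) τ (pow_ne_zero 4 h2)
        (pow_ne_zero 4 h3) (d2.pow 4) (d3.pow 4), logDeriv_fun_pow d2 4, logDeriv_fun_pow d3 4,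
      ← four_mul_logDeriv_theta2_sub_theta3 hτ]
    push_cast
    ring
  have e : deriv lamC τ = lamC τ * (π * I * theta4 τ ^ 4) := by
    rw [← hlog, logDeriv_apply, mul_div_cancel₀ _ hl0]
  rw [← e]
  exact hd.hasDerivAt

/-- **`(d/dt) λ(it) = -π λ(it) θ₄(it)⁴`** (real form of `λ′ = πi θ₄⁴ λ`). [cite: KlebanZagier2003, §3] -/
theorem hasDerivAt_lamR (ht : 0 < t) :
    HasDerivAt lamR (-(π * lamR t * (theta4 (I * t)).re ^ 4)) t := by
  have him : 0 < im (I * t : ℂ) := by simpa using ht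
  have hc : HasDerivAt (lamC ∘ fun s : ℝ => (I * s : ℂ))
      (lamC (I * t) * (π * I * theta4 (I * t) ^ 4) * I) t :=
    HasDerivAt.comp t (by exact hasDerivAt_lamC him) (hasDerivAt_I_mul t)
  have hre := hasDerivAt_re_of_real hc
  have hev : (fun s => ((lamC ∘ fun s : ℝ => (I * s : ℂ)) s).re) =ᶠ[𝓝 t] lamR := by
    filter_upwards [isOpen_Ioi.mem_nhds (Set.mem_Ioi.mpr ht)] with s hs
    rw [Function.comp_apply, lamC_I_mul (Set.mem_Ioi.mp hs), Complex.ofReal_re]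
  refine (hre.congr_of_eventuallyEq hev.symm).congr_deriv ?_
  rw [lamC_I_mul ht, theta4_I_mul_eq_re ht]
  have e : ((lamR t : ℂ)) * (π * I * ((theta4 (I * t)).re : ℂ) ^ 4) * I =
      ((-(π * lamR t * (theta4 (I * t)).re ^ 4) : ℝ) : ℂ) := by
    push_cast
    linear_combination (↑π * ↑(lamR t) * (((theta4 (I * ↑t)).re : ℂ)) ^ 4) * I_sq
  rw [e]
  simp only [Complex.ofReal_re]

/-- **`λ(i/t) = 1 - λ(it)`** (the `S`-laws `θ₂(i/t) = √t θ₄(it)`, `θ₃(i/t) = √t θ₃(it)`).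
[cite: KlebanZagier2003, §3] -/
theorem lamR_inv (ht : 0 < t) : lamR t⁻¹ = 1 - lamR t := by
  have him : 0 < im (I * t : ℂ) := by simpa using ht
  have h2 : theta2 (I * (t⁻¹ : ℝ)) = ((t ^ (1 / 2 : ℝ) : ℝ) : ℂ) * theta4 (I * t) := by
    have h := theta4_I_mul ht
    rw [h, ← mul_assoc, ← Complex.ofReal_mul, ← Real.rpow_add ht,
      show (1 / 2 : ℝ) + -(1 / 2) = 0 by ring, Real.rpow_zero, Complex.ofReal_one, one_mul]
  have h3 : theta3 (I * (t⁻¹ : ℝ)) = ((t ^ (1 / 2 : ℝ) : ℝ) : ℂ) * theta3 (I * t) := by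
    have h := theta3_neg_one_div him
    rwa [neg_one_div_I_mul ht, cpow_half_I_mul ht] at h
  have hs : 0 < t ^ (1 / 2 : ℝ) := Real.rpow_pos_of_pos ht _
  rw [one_sub_lamR ht, lamR, h2, h3, theta4_I_mul_eq_re ht, theta3_I_mul_eq_re ht]
  simp only [← Complex.ofReal_mul, Complex.ofReal_re]
  have h3pos := theta3_I_mul_re_pos ht
  rw [mul_pow, mul_pow, mul_div_mul_left _ _ (pow_ne_zero 4 hs.ne')]

/-- **`λ(it) → 0` as `t → ∞`.** [folklore] -/
theorem tendsto_lamR_atTop : Tendsto lamR atTop (𝓝 0) := by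
  have hθ2 := isBigOqhat_theta2_pow_four.tendsto
  have hθ3 := (isBigOqhat_theta3.pow 4).tendsto
  rw [one_pow] at hθ3
  have hdiv := hθ2.div hθ3 one_ne_zero
  rw [zero_div] at hdiv
  have hax : Tendsto (fun t : ℝ => (I * t : ℂ)) atTop (comap im atTop) := by
    refine tendsto_comap_iff.mpr ?_
    have : (im ∘ fun t : ℝ => (I * t : ℂ)) = id := by funext t; simp
    rw [this]
    exact tendsto_id
  have h := (Complex.continuous_re.tendsto 0).comp (hdiv.comp hax)
  rw [Complex.zero_re] at h
  refine h.congr' ?_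
  filter_upwards [eventually_gt_atTop (0 : ℝ)] with t ht
  show (theta2 (I * ↑t) ^ 4 / theta3 (I * ↑t) ^ 4).re = lamR t
  rw [← lamC, lamC_I_mul ht, Complex.ofReal_re]

end LambdaAxis

/-! ### The generalized Cardy function and the conclusion of Theorem 2 -/

section Final

open Literature.NumberTheory.EllipticCurves.JacobiThetaNull

variable {α : ℝ}

/-- `₂F₁(a, b; c; x) = ₂F₁(b, a; c; x)`. [folklore] -/
theorem hypergeometric_symm (a b c x : ℝ) : ₂F₁ a b c x = ₂F₁ b a c x := by
  unfold ordinaryHypergeometric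
  rw [ordinaryHypergeometricSeries_symm]

/-- `Φ₀(η) = η^α ₂F₁(α, 1-α; 1+α; η)` in the parametrisation `(1-α, α; α+1)` of
`GaussIncompleteBeta`. [folklore] -/
theorem rpow_mul_hyp_eq (α η : ℝ) :
    η ^ α * ₂F₁ α (1 - α) (1 + α) η = η ^ α * ₂F₁ (1 - α) α (α + 1) η := by
  rw [hypergeometric_symm, add_comm]

/-- `genCardyFunction α η = K₀ · (η^α ₂F₁(1-α, α; α+1; η))`, `K₀ = Γ(2α)/(Γ(α)Γ(1+α))`. [folklore] -/
theorem genCardyFunction_eq (α η : ℝ) :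
    genCardyFunction α η =
      Real.Gamma (2 * α) / (Real.Gamma α * Real.Gamma (1 + α)) * (η ^ α * ₂F₁ (1 - α) α (α + 1) η) := by
  rw [genCardyFunction, ← rpow_mul_hyp_eq]; ring

/-- **`(d/dη) genCardyFunction α η = K₀ α η^{α-1} (1-η)^{α-1}`** on `(0, 1)`, `0 < α < 1`
(`GaussIncompleteBeta.hasDerivAt_rpow_mul_hypergeometric_gauss`). [folklore] -/
theorem hasDerivAt_genCardyFunction (hα : 0 < α) (hα1 : α < 1) {η : ℝ} (hη : η ∈ Set.Ioo (0 : ℝ) 1) :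
    HasDerivAt (genCardyFunction α)
      (Real.Gamma (2 * α) / (Real.Gamma α * Real.Gamma (1 + α)) *
        (α * (η ^ (α - 1) * (1 - η) ^ (-(1 - α))))) η := by
  have h := hasDerivAt_rpow_mul_hypergeometric_gauss (α := 1 - α) (β := α) (by linarith) hα hη
  have h' := h.const_mul (Real.Gamma (2 * α) / (Real.Gamma α * Real.Gamma (1 + α)))
  refine h'.congr_of_eventuallyEq (Eventually.of_forall fun x => ?_)
  rw [genCardyFunction_eq]

/-- **`genCardyFunction α η → 0` as `η → 0⁺`.** [folklore] -/
theorem tendsto_genCardyFunction_zero (hα : 0 < α) (hα1 : α < 1) :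
    Tendsto (genCardyFunction α) (𝓝[Set.Ioo 0 1] 0) (𝓝 0) := by
  have hc := continuousOn_rpow_mul_hypergeometric_gauss (α := 1 - α) (β := α) (by linarith) hα
  have h0 : (0 : ℝ) ∈ Set.Ico (0 : ℝ) 1 := ⟨le_rfl, one_pos⟩
  have hcw := (hc 0 h0).tendsto
  simp only [Real.zero_rpow hα.ne', zero_mul] at hcw
  have hcw' : Tendsto (fun s : ℝ => s ^ α * ₂F₁ (1 - α) α (α + 1) s) (𝓝[Set.Ioo 0 1] 0) (𝓝 0) :=
    hcw.mono_left (nhdsWithin_mono _ Set.Ioo_subset_Ico_self)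
  have := hcw'.const_mul (Real.Gamma (2 * α) / (Real.Gamma α * Real.Gamma (1 + α)))
  rw [mul_zero] at this
  refine this.congr fun x => ?_
  rw [genCardyFunction_eq]

/-- **`genCardyFunction α η → 1` as `η → 1⁻`**: through the incomplete beta integral
`η^α ₂F₁ = α ∫₀^η u^{α-1}(1-u)^{α-1} du`, continuous up to `1`, where Euler's beta integral
gives `α Γ(α)²/Γ(2α)`, and `K₀ α Γ(α)²/Γ(2α) = 1`. [folklore] -/
theorem tendsto_genCardyFunction_one (hα : 0 < α) (hα1 : α < 1) :
    Tendsto (genCardyFunction α) (𝓝[Set.Ico 0 1] 1) (𝓝 1) := by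
  set K₀ : ℝ := Real.Gamma (2 * α) / (Real.Gamma α * Real.Gamma (1 + α)) with hK₀
  set J : ℝ → ℝ := fun w => ∫ u in (0 : ℝ)..w, u ^ (α - 1) * (1 - u) ^ (-(1 - α)) with hJ
  have hJc := continuousOn_integral_betaKernel_one (α := 1 - α) (β := α) (by linarith) hα
  have hJ1 : J 1 = Real.Gamma α * Real.Gamma α / Real.Gamma (2 * α) := by
    have := integral_betaKernel_eq_Gamma (α := 1 - α) (β := α) (by linarith) hα
    rw [hJ]
    simp only at this ⊢
    rw [this, show (1 : ℝ) - (1 - α) = α by ring, show α + 1 - (1 - α) = 2 * α by ring]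
  have hΓα : 0 < Real.Gamma α := Real.Gamma_pos_of_pos hα
  have hΓ2 : 0 < Real.Gamma (2 * α) := Real.Gamma_pos_of_pos (by linarith)
  have hval : K₀ * (α * J 1) = 1 := by
    rw [hJ1, hK₀, add_comm 1 α, Real.Gamma_add_one hα.ne']
    field_simp
  -- `genCardyFunction α η = K₀ α J(η)` on `[0,1)`
  have heq : ∀ η ∈ Set.Ico (0 : ℝ) 1, genCardyFunction α η = K₀ * (α * J η) := by
    intro η hη
    rw [genCardyFunction_eq, rpow_mul_hypergeometric_eq_integral (α := 1 - α) (β := α) (by linarith) hα hη]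
  have hJt : Tendsto J (𝓝[Set.Ico 0 1] 1) (𝓝 (J 1)) :=
    ((hJc 1 ⟨zero_le_one, le_rfl⟩).tendsto).mono_left (nhdsWithin_mono _ Set.Ico_subset_Icc_self)
  have h2 := (hJt.const_mul α).const_mul K₀
  rw [hval] at h2
  refine h2.congr' ?_
  filter_upwards [self_mem_nhdsWithin] with η hη using (heq η hη).symm

variable {a : ℕ → ℝ} {C : ℝ} {m : ℕ} {P : ℝ → ℝ} {t : ℝ}

/-- `P(t) = Re P(it)` has derivative `Re(i f(it))` for `t > 0`. [folklore] -/
theorem hasDerivAt_P (hP : IsConformalBlock P α a)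
    (h : ∀ n : ℕ, |a n| ≤ C * ((n : ℝ) + 1) ^ m) (hC : 0 ≤ C) (ht : 0 < t) :
    HasDerivAt P ((blockDer a α (I * t) * I).re) t := by
  have him : 0 < im (I * t : ℂ) := by simpa using ht
  have hc : HasDerivAt (blockExt a α ∘ fun s : ℝ => (I * s : ℂ)) (blockDer a α (I * t) * I) t :=
    HasDerivAt.comp t (by exact hasDerivAt_blockExt h hC him) (hasDerivAt_I_mul t)
  have hre := hasDerivAt_re_of_real hc
  have hev : (fun s => ((blockExt a α ∘ fun s : ℝ => (I * s : ℂ)) s).re) =ᶠ[𝓝 t] P := by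
    filter_upwards [isOpen_Ioi.mem_nhds (Set.mem_Ioi.mpr ht)] with s hs
    rw [Function.comp_apply, blockExt_I_mul hP (Set.mem_Ioi.mp hs), Complex.ofReal_re]
  exact hre.congr_of_eventuallyEq hev.symm

/-- `P(t) → 0` as `t → ∞` (`α > 0`). [folklore] -/
theorem tendsto_P_atTop (hP : IsConformalBlock P α a)
    (h : ∀ n : ℕ, |a n| ≤ C * ((n : ℝ) + 1) ^ m) (hC : 0 ≤ C) (hα : 0 < α) :
    Tendsto P atTop (𝓝 0) := by
  -- `|P(t)| ≤ e^{-πα t} M` for `t ≥ 1`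
  obtain ⟨M, Y, hM, hY, hb⟩ := (isBigOqhat_discFun_qhat (norm_coef_le h) hC).norm_le
  rw [tendsto_zero_iff_norm_tendsto_zero]
  have hlim : Tendsto (fun t : ℝ => rexp (-(π * α * t)) * M) atTop (𝓝 0) := by
    have ht : Tendsto (fun t : ℝ => rexp (-(π * α * t)) * M) atTop (𝓝 (0 * M)) := by
      refine (Real.tendsto_exp_atBot.comp ?_).mul_const M
      exact tendsto_neg_atTop_atBot.comp (tendsto_id.const_mul_atTop (by positivity))
    rwa [zero_mul] at ht
  refine squeeze_zero' (Eventually.of_forall fun t => norm_nonneg _) ?_ hlim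
  filter_upwards [eventually_ge_atTop (max Y 1)] with t ht
  have ht0 : 0 < t := by linarith [le_max_right Y 1]
  have hτ : Y ≤ im (I * t : ℂ) := by simpa using le_trans (le_max_left _ _) ht
  have e : P t = (blockExt a α (I * t)).re := by rw [blockExt_I_mul hP ht0, Complex.ofReal_re]
  rw [e]
  refine (Complex.abs_re_le_norm _).trans ?_
  rw [blockExt, norm_mul, Complex.norm_exp]
  have er : (π * I * α * (I * t) : ℂ).re = -(π * α * t) := by
    simp [mul_re, mul_im]
  rw [er]
  exact mul_le_mul_of_nonneg_left (hb _ hτ) (Real.exp_pos _).le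

/-- **Kleban–Zagier, Theorem 2 (corrected): the identification `Π₁(r) = Π_h(r;α)`.** With
`0 < α ≤ 1/2` from `theorem2_dim`: on the positive axis `f(it) = K θ₃(it)⁴ (λ(1-λ))^α(it)`
(`exists_blockDer_axis_eq`), so `P′(t)` and `(d/dt) Π_h(t;α)` are both constant multiples of
`θ₃(it)⁴(λ(1-λ))^α(it)` (`λ′ = πiθ₄⁴λ`, Gauss's incomplete-beta identity); both `P` and `Π_h(·;α)`
vanish at `t = ∞`, so `P = κ Π_h(·;α)`, and the duality (ii) together with `Π_h(0⁺;α) = 0`,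
`Π_h(1⁻;α) = 1` (Euler's beta integral) forces `κ = 1`.
[cite: KlebanZagier2003, §5 Theorem 2] -/
theorem theorem2_identification (hP : IsConformalBlock P α a)
    (h : ∀ n : ℕ, |a n| ≤ C * ((n : ℝ) + 1) ^ m) (hC : 0 ≤ C)
    (hdual : ∀ r : ℝ, 0 < r → P (1 / r) = 1 - P r)
    (hnc : ∃ r s : ℝ, 0 < r ∧ 0 < s ∧ P r ≠ P s) (hα : 0 < α) (hα2 : α ≤ 1 / 2) :
    ∀ t : ℝ, 0 < t → P t = genCardyFunction α (lamR t) := by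
  have hα1 : α < 1 := by linarith
  obtain ⟨K, hK⟩ := exists_blockDer_axis_eq hP h hC hdual hnc hα
  set K₀ : ℝ := Real.Gamma (2 * α) / (Real.Gamma α * Real.Gamma (1 + α)) with hK₀
  have hΓα : 0 < Real.Gamma α := Real.Gamma_pos_of_pos hα
  have hΓ1 : 0 < Real.Gamma (1 + α) := Real.Gamma_pos_of_pos (by linarith)
  have hΓ2 : 0 < Real.Gamma (2 * α) := Real.Gamma_pos_of_pos (by linarith)
  have hK₀pos : 0 < K₀ := by positivity
  -- the common factor `g(t) = θ₃(it)⁴ ρ(it)^α`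
  set g : ℝ → ℝ := fun t => (theta3 (I * t)).re ^ 4 * rhoR t ^ α with hg
  have hpsi : ∀ t : ℝ, 0 < t → psiAxis α t = (g t : ℂ) := by
    intro t ht
    rw [psiAxis, theta3_I_mul_eq_re ht, hg]
    push_cast
    ring
  set κ₁ : ℝ := (K * I).re with hκ₁
  set cT : ℝ := -(π * α * K₀) with hcT
  have hcT0 : cT ≠ 0 := by rw [hcT]; exact neg_ne_zero.mpr (by positivity)
  set T : ℝ → ℝ := fun t => genCardyFunction α (lamR t) with hT
  -- derivatives
  have hdP : ∀ t : ℝ, 0 < t → HasDerivAt P (κ₁ * g t) t := by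
    intro t ht
    have hd := hasDerivAt_P hP h hC ht
    rw [hK t ht, hpsi t ht] at hd
    have e : (K * (g t : ℂ) * I).re = κ₁ * g t := by
      rw [show K * (g t : ℂ) * I = (g t : ℂ) * (K * I) by ring, Complex.re_ofReal_mul, hκ₁, mul_comm]
    rwa [e] at hd
  have hdT : ∀ t : ℝ, 0 < t → HasDerivAt T (cT * g t) t := by
    intro t ht
    have hl := lamR_mem_Ioo ht
    have hcomp := (hasDerivAt_genCardyFunction hα hα1 hl).comp t (hasDerivAt_lamR ht)
    refine hcomp.congr_deriv ?_
    -- algebra: `K₀ α λ^{α-1} (1-λ)^{α-1} · (-π λ θ₄⁴) = cT · θ₃⁴ (λ(1-λ))^α`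
    have hl0 : 0 < lamR t := hl.1
    have hl1 : 0 < 1 - lamR t := by linarith [hl.2]
    have h3 := pow_pos (theta3_I_mul_re_pos ht) 4
    have hθ4 : (theta4 (I * t)).re ^ 4 = (1 - lamR t) * (theta3 (I * t)).re ^ 4 := by
      rw [one_sub_lamR ht, div_mul_cancel₀ _ h3.ne']
    have hρ : rhoR t ^ α = lamR t ^ α * (1 - lamR t) ^ α := by
      rw [rhoR_eq ht, Real.mul_rpow hl0.le hl1.le]
    have e1 : lamR t ^ (α - 1) = lamR t ^ α / lamR t := Real.rpow_sub_one hl0.ne' α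
    have e2 : (1 - lamR t) ^ (-(1 - α)) = (1 - lamR t) ^ α / (1 - lamR t) := by
      rw [show -(1 - α) = α - 1 by ring, Real.rpow_sub_one hl1.ne' α]
    show _ = cT * ((theta3 (I * ↑t)).re ^ 4 * rhoR t ^ α)
    rw [hρ, hθ4, e1, e2, hcT, hK₀]
    field_simp
  -- `Q = P - (κ₁/cT) T` is constant on `(0, ∞)`, and tends to `0`, hence vanishes
  set Q : ℝ → ℝ := fun t => P t - κ₁ / cT * T t with hQ
  have hdQ : ∀ t : ℝ, 0 < t → HasDerivAt Q 0 t := by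
    intro t ht
    have := (hdP t ht).sub ((hdT t ht).const_mul (κ₁ / cT))
    refine this.congr_deriv ?_
    field_simp
    ring
  have hQconst : ∀ t : ℝ, 0 < t → Q t = Q 1 := fun t ht =>
    isOpen_Ioi.is_const_of_deriv_eq_zero (convex_Ioi (0 : ℝ)).isPreconnected
      (fun s hs => (hdQ s hs).differentiableAt.differentiableWithinAt)
      (fun s hs => (hdQ s hs).deriv) ht (Set.mem_Ioi.mpr one_pos)
  have hTlim : Tendsto T atTop (𝓝 0) := by
    have hl : Tendsto lamR atTop (𝓝[Set.Ioo 0 1] 0) :=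
      tendsto_nhdsWithin_iff.mpr ⟨tendsto_lamR_atTop, by
        filter_upwards [eventually_gt_atTop (0 : ℝ)] with t ht using lamR_mem_Ioo ht⟩
    exact (tendsto_genCardyFunction_zero hα hα1).comp hl
  have hQlim : Tendsto Q atTop (𝓝 (0 - κ₁ / cT * 0)) :=
    (tendsto_P_atTop hP h hC hα).sub (hTlim.const_mul _)
  rw [mul_zero, sub_zero] at hQlim
  have hQ1 : Q 1 = 0 := by
    have h1 : Tendsto Q atTop (𝓝 (Q 1)) :=
      tendsto_const_nhds.congr' (by
        filter_upwards [eventually_gt_atTop (0 : ℝ)] with t ht using (hQconst t ht).symm)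
    exact tendsto_nhds_unique h1 hQlim
  have hPT : ∀ t : ℝ, 0 < t → P t = κ₁ / cT * T t := by
    intro t ht
    have := hQconst t ht
    rw [hQ1, hQ] at this
    linarith
  -- `κ = 1` from the duality and the limits at the two ends
  set κ : ℝ := κ₁ / cT with hκ
  have hsum : ∀ t : ℝ, 0 < t → κ * (T t + genCardyFunction α (1 - lamR t)) = 1 := by
    intro t ht
    have h1 := hPT t ht
    have h2 := hPT t⁻¹ (inv_pos.mpr ht)
    have h3 := hdual t ht
    rw [one_div] at h3
    rw [h3, h1] at h2
    rw [hT] at h2 ⊢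
    simp only at h2 ⊢
    rw [lamR_inv ht] at h2
    linarith
  have hlim1 : Tendsto (fun t : ℝ => genCardyFunction α (1 - lamR t)) atTop (𝓝 1) := by
    have hl : Tendsto (fun t => 1 - lamR t) atTop (𝓝[Set.Ico 0 1] 1) := by
      refine tendsto_nhdsWithin_iff.mpr ⟨?_, ?_⟩
      · have := tendsto_lamR_atTop.const_sub 1
        rwa [sub_zero] at this
      · filter_upwards [eventually_gt_atTop (0 : ℝ)] with t ht
        have := lamR_mem_Ioo ht
        exact ⟨by linarith [this.2], by linarith [this.1]⟩
    exact (tendsto_genCardyFunction_one hα hα1).comp hl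
  have hκ1 : κ = 1 := by
    have hl : Tendsto (fun t : ℝ => κ * (T t + genCardyFunction α (1 - lamR t))) atTop (𝓝 (κ * (0 + 1))) :=
      (hTlim.add hlim1).const_mul κ
    have hl' : Tendsto (fun t : ℝ => κ * (T t + genCardyFunction α (1 - lamR t))) atTop (𝓝 1) :=
      tendsto_const_nhds.congr' (by
        filter_upwards [eventually_gt_atTop (0 : ℝ)] with t ht using (hsum t ht).symm)
    have := tendsto_nhds_unique hl hl'
    linarith
  intro t ht
  rw [hPT t ht, hκ1, one_mul]

/-- **Kleban–Zagier, Theorem 2 — corrected statement, proved.** "Let `Π₁(r)` be any function on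
the positive real axis such that (i′) `Π₁(r)` is a conformal block of dimension `α ∈ ℝ` with
coefficients `aₙ` of polynomial growth; (ii) `Π₁(1/r) = 1 - Π₁(r)`. Then `0 < α ≤ 1/2` and
`Π₁(r) = Π_h(r;α)`, the generalized Cardy's function" — under the hypothesis, omitted in print
and used by the printed proof, that `Π₁` is not constant (the constant block `Π₁ ≡ 1/2` of
dimension `0` is a counterexample to the literal statement: `theorem2_false`). Here
`Π_h(r;α) = F(λ(ir); 4/(1-α)) = genCardyFunction α (modularLambdaI r)`.
[cite: KlebanZagier2003, §5 Theorem 2] -/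
theorem theorem2_corrected (P : ℝ → ℝ) (α : ℝ) (a : ℕ → ℝ) (hP : IsConformalBlock P α a)
    (hgr : ∃ C k : ℝ, ∀ n : ℕ, |a n| ≤ C * ((n : ℝ) + 1) ^ k)
    (hdual : ∀ r : ℝ, 0 < r → P (1 / r) = 1 - P r)
    (hnc : ∃ r s : ℝ, 0 < r ∧ 0 < s ∧ P r ≠ P s) :
    0 < α ∧ α ≤ 1 / 2 ∧ ∀ r : ℝ, 0 < r → P r = genCardyFunction α (modularLambdaI r) := by
  obtain ⟨hα, hα2⟩ := theorem2_dim P α a hP hgr hdual hnc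
  obtain ⟨C, m, hC, h⟩ := polyGrowth_nat hgr
  refine ⟨hα, hα2, fun r hr => ?_⟩
  rw [modularLambdaI_eq_lamR hr]
  exact theorem2_identification hP h hC hdual hnc hα hα2 r hr

end Final

/-! ### The degenerate case and the dichotomy behind the misstatement -/

section Dichotomy

variable {a : ℕ → ℝ} {α : ℝ} {P : ℝ → ℝ}

/-- **The constant case.** If a conformal block `Π₁` of dimension `α` with polynomially bounded
coefficients satisfies `Π₁(1/r) = 1 - Π₁(r)` and is constant on `(0,∞)`, then `α = 0` and
`Π₁ ≡ 1/2` there: exactly the counterexample of `theorem2_false`. [folklore] -/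
theorem theorem2_constant_case (hP : IsConformalBlock P α a)
    (hgr : ∃ C k : ℝ, ∀ n : ℕ, |a n| ≤ C * ((n : ℝ) + 1) ^ k)
    (hdual : ∀ r : ℝ, 0 < r → P (1 / r) = 1 - P r)
    (hc : ∀ r s : ℝ, 0 < r → 0 < s → P r = P s) :
    α = 0 ∧ ∀ r : ℝ, 0 < r → P r = 1 / 2 := by
  obtain ⟨C, m, hC, h⟩ := polyGrowth_nat hgr
  have hhalf : ∀ r : ℝ, 0 < r → P r = 1 / 2 := by
    intro r hr
    have h1 := hdual 1 one_pos
    rw [div_one] at h1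
    have : P 1 = 1 / 2 := by linarith
    rw [hc r 1 hr one_pos, this]
  refine ⟨?_, hhalf⟩
  -- `G(q̂(ir)) = ½ e^{παr}` for `r > 0`, while `G(q̂(ir)) → a₀ ≠ 0`
  have hG : ∀ r : ℝ, 0 < r → discFun (coef a) (qhat (I * r)) = (1 / 2 : ℂ) * cexp (π * α * r) := by
    intro r hr
    have e := blockExt_I_mul hP hr
    rw [hhalf r hr, blockExt] at e
    have hE : cexp (π * I * α * (I * r)) = cexp (-(π * α * r)) := by
      congr 1
      linear_combination (↑π * ↑α * ↑r : ℂ) * I_sq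
    rw [hE] at e
    have hE0 : cexp (-(π * α * r) : ℂ) ≠ 0 := Complex.exp_ne_zero _
    calc discFun (coef a) (qhat (I * r))
        = cexp (π * α * r) * (cexp (-(π * α * r)) * discFun (coef a) (qhat (I * r))) := by
          rw [← mul_assoc, ← Complex.exp_add, add_neg_cancel, Complex.exp_zero, one_mul]
      _ = (1 / 2 : ℂ) * cexp (π * α * r) := by rw [e]; push_cast; ring
  have hlim : Tendsto (fun r : ℝ => discFun (coef a) (qhat (I * r))) atTop (𝓝 (coef a 0)) :=
    (tendsto_discFun_zero (norm_coef_le h) hC).comp tendsto_qhat_I_mul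
  have ha0 : coef a 0 ≠ 0 := by rw [coef]; exact_mod_cast hP.1
  by_contra hα
  rcases lt_or_gt_of_ne hα with hneg | hpos
  · -- `α < 0`: the right-hand side tends to `0`
    have h0 : Tendsto (fun r : ℝ => (1 / 2 : ℂ) * cexp (π * α * r)) atTop (𝓝 0) := by
      rw [tendsto_zero_iff_norm_tendsto_zero]
      have : Tendsto (fun r : ℝ => 1 / 2 * rexp (π * α * r)) atTop (𝓝 (1 / 2 * 0)) := by
        refine (Real.tendsto_exp_atBot.comp ?_).const_mul _
        have : Tendsto (fun r : ℝ => (π * α) * r) atTop atBot :=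
          tendsto_id.const_mul_atTop_of_neg (by nlinarith [Real.pi_pos])
        exact this.congr fun r => by ring
      rw [mul_zero] at this
      refine this.congr fun r => ?_
      rw [norm_mul, Complex.norm_exp]
      simp
    have hlim' : Tendsto (fun r : ℝ => discFun (coef a) (qhat (I * r))) atTop (𝓝 0) :=
      h0.congr' (by filter_upwards [eventually_gt_atTop (0 : ℝ)] with r hr using (hG r hr).symm)
    exact ha0 (tendsto_nhds_unique hlim hlim')
  · -- `α > 0`: the right-hand side is unbounded
    have hbdd : ∀ᶠ r : ℝ in atTop, ‖discFun (coef a) (qhat (I * r))‖ ≤ ‖coef a 0‖ + 1 := by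
      have := hlim.norm
      exact this.eventually (Iic_mem_nhds (by linarith [norm_nonneg (coef a 0)]))
    have hgrow : Tendsto (fun r : ℝ => ‖(1 / 2 : ℂ) * cexp (π * α * r)‖) atTop atTop := by
      have : Tendsto (fun r : ℝ => 1 / 2 * rexp (π * α * r)) atTop atTop :=
        (Real.tendsto_exp_atTop.comp (tendsto_id.const_mul_atTop (by positivity))).const_mul_atTop
          (by norm_num)
      refine this.congr fun r => ?_
      rw [norm_mul, Complex.norm_exp]
      simp
    have hev := hgrow.eventually (eventually_gt_atTop (‖coef a 0‖ + 1))
    obtain ⟨r, h1, h2, h3⟩ := (hbdd.and (hev.and (eventually_gt_atTop (0 : ℝ)))).exists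
    rw [hG r h3] at h1
    exact absurd h1 (not_le.mpr h2)

/-- **The dichotomy.** Under hypotheses (i′) and (ii) of Theorem 2 as printed, either `Π₁` is the
constant block `1/2` of dimension `0` (the counterexample), or `0 < α ≤ 1/2` and `Π₁ = Π_h(·;α)`.
[cite: KlebanZagier2003, §5 Theorem 2] -/
theorem theorem2_dichotomy (P : ℝ → ℝ) (α : ℝ) (a : ℕ → ℝ) (hP : IsConformalBlock P α a)
    (hgr : ∃ C k : ℝ, ∀ n : ℕ, |a n| ≤ C * ((n : ℝ) + 1) ^ k)
    (hdual : ∀ r : ℝ, 0 < r → P (1 / r) = 1 - P r) :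
    (α = 0 ∧ ∀ r : ℝ, 0 < r → P r = 1 / 2) ∨
    (0 < α ∧ α ≤ 1 / 2 ∧ ∀ r : ℝ, 0 < r → P r = genCardyFunction α (modularLambdaI r)) := by
  by_cases hc : ∀ r s : ℝ, 0 < r → 0 < s → P r = P s
  · exact Or.inl (theorem2_constant_case hP hgr hdual hc)
  · right
    push Not at hc
    obtain ⟨r, s, hr, hs, hne⟩ := hc
    exact theorem2_corrected P α a hP hgr hdual ⟨r, s, hr, hs, hne⟩

end Dichotomy

end Literature.Probability.RandomPlanarGeometry.KlebanZagier

end
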